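import Summits.CriticalPhenomena.SAWScalingLimit.Theorems.SAWLoopFugacityFlowIsingBoundaryRatioWindowRectSucc
import Summits.CriticalPhenomena.SAWScalingLimit.Theorems.SAWLoopFugacityFlowIsingBoundaryRatioWindowRectCover
import Literature.Probability.LatticeModels.HoleFreePotential
import Literature.Probability.LatticeModels.DiscreteDualBoundaryTrace
import Literature.Probability.LatticeModels.DiscreteRectBoundaryTrace
import Literature.Probability.LatticeModels.FKIsingTopologicalRectangleCrossing

/-!
# The edge set of a hole-free, side-connected set of unit squares is a discrete topological rectangle
(route CardyQContinuation, serves stmt-CriticalPhenomena-5560, registered stub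
`stub_loopSymmetricLimit_isRect_of_faces` of the n = 0 bridge of the crux `IsingJetsConformal`)

The n = 0 bridge applies the Chelkak–Smirnov crossing theorem to designed polyominoes, which must be
presented as `DiscreteRect.IsRect E d₀ n` (`FKIsingTopologicalRectangleCrossing.lean`): one
boundary-tracing orbit of `DiscreteRect.succ E` through all external darts, cut into four arcs.
This file is the PRODUCER of such presentations. Let `F` be a nonempty finite set of unit squares of
`ℤ²` (indexed by lower-left corners) which is side-connected and hole-free
(`Literature.Probability.LatticeModels.HoleFree`), and let `E` be the set of all sides of squares of `F`.
Then

* `E` is a face domain (`DiscreteRect.IsFaceDomain`): an arrow on a side of `s ∈ F` has `s` as its left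
  or right square, and every square of `F` is a face of `E`;
* for every external dart `d₀` the orbit of `succ E` has a period `N > 0` within which the darts are
  pairwise distinct (`discreteRect_exists_period` of the sibling crux `SAWScalingLimit.IsingBoundaryRatio`,
  file `…WindowRectSucc.lean`; the same theorem is re-exported by the registered stub
  `stub_loopSymmetricLimit_succPeriodic`), and it passes through EVERY external dart — the cover
  theorem `exists_iterate_succ_eq_of_escape` of the same sibling crux (file `…WindowRectCover.lean`),
  whose three hypotheses are checked here: sides are lattice edges; any two vertices of `E` are corners
  of squares `s, t ∈ F` and are joined through the sides of the squares of a face chain from `s` to `t`;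
  a square with a missing side is off `F`, so hole-freeness of `F` lets it escape upwards through
  side-adjacent squares off `F`, and the side crossed at each step is not in `E` because the only two
  squares having it as a side are the two (off-`F`) squares it separates (`IsRectOfFaces.eq_or_eq_of_side_eq`);
* hence `(E, d₀, n)` is an `IsRect` for every `n : Fin 4 → ℕ` with positive entries summing to `N`.

All of it is lattice bookkeeping. [folklore]

References: D. Chelkak, H. Duminil-Copin, C. Hongler, EJP 21 (2016) no. 5, §2.1; S. Smirnov, Ann. Math.
172 (2010), §3 (simply connected lattice domains).
-/

namespace Summit.CriticalPhenomena.CardyFormulaZ2.Theorems.CardyQContinuation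

open Literature.Probability.LatticeModels Literature.Probability.LatticeModels.DiscreteRect
open Summit.CriticalPhenomena.SAWScalingLimit.Theorems.IsingBoundaryRatio

namespace IsRectOfFaces

/-! ### Two lattice identities -/

/-- The `k`-th corner of the square across the `(k+1)`-st side of `s` is the `(k+1)`-st corner of `s`:
`corner (s + e_k) k = corner s (k + 1)`. [folklore] -/
theorem corner_add_dir (s : Site 2) (k : Fin 4) : corner (s + dir k) k = corner s (k + 1) := by
  rw [Site.eq_iff_two]
  fin_cases k <;> simp [corner, dir]

/-- The square to the right of the `j`-th side of `a` (seen as an arrow from the `j`-th corner) is the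
square across that side: `quad (corner a j) (j + 3) = a + e_{j+3}`. [folklore] -/
theorem quad_corner_add_three (a : Site 2) (j : Fin 4) : quad (corner a j) (j + 3) = a + dir (j + 3) := by
  rw [Site.eq_iff_two]
  fin_cases j <;> simp [quad, corner, dir]

/-- **The two squares flanking a side.** If the `j`-th side of the square `a` is the `j'`-th side of
the square `s`, then `s = a` or `s` is the square across the `j`-th side of `a`. [folklore] -/
theorem eq_or_eq_of_side_eq {a s : Site 2} {j j' : Fin 4}
    (h : s(corner a j, corner a j + dir j) = s(corner s j', corner s j' + dir j')) :
    s = a ∨ s = a + dir (j + 3) := by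
  rcases Sym2.eq_iff.1 h with ⟨h1, h2⟩ | ⟨h1, h2⟩
  · rw [h1, add_right_inj] at h2
    obtain rfl : j = j' := dir_injective h2
    exact Or.inl (corner_injective j h1).symm
  · rw [h1, add_assoc, add_eq_left, dir_add_dir_eq_zero_iff] at h2
    subst h2
    have k1 : ∀ j' : Fin 4, j' + 2 + 3 = j' + 1 := by decide
    rw [← corner_add_one] at h1
    refine Or.inr ?_
    rw [← quad_corner_add_three, k1, h1, quad_corner]

variable {F : Finset (Site 2)} {E : Finset (Sym2 (Site 2))}
  (hchar : ∀ e, e ∈ E ↔ ∃ s ∈ F, ∃ j : Fin 4, e = s(corner s j, corner s j + dir j))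
include hchar

/-! ### Sides and faces -/

/-- Every square of `F` is a face of `E`. [folklore] -/
theorem inF_of_mem {s : Site 2} (hs : s ∈ F) : InF E s := fun j => (hchar _).2 ⟨s, hs, j, rfl⟩

/-- The `j`-th side of a square of `F`, from its `j`-th to its `(j+1)`-st corner, is an edge of `E`.
[folklore] -/
theorem side_mem {s : Site 2} (hs : s ∈ F) (j : Fin 4) : s(corner s j, corner s (j + 1)) ∈ E := by
  rw [corner_add_one]
  exact inF_of_mem hchar hs j

/-- A square with a missing side is not in `F`. [folklore] -/
theorem not_mem_of_side_not_mem {g : Site 2} {j : Fin 4} (h : s(corner g j, corner g j + dir j) ∉ E) :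
    g ∉ F := fun hg => h (inF_of_mem hchar hg j)

/-- **`E` is a face domain**: an arrow on an edge of `E` has a square of `F` on its left or on its right.
[folklore] -/
theorem isFaceDomain : IsFaceDomain E := by
  rintro ⟨p, m⟩ ha
  rw [aedge_mk] at ha
  obtain ⟨s, hs, j, he⟩ := (hchar _).1 ha
  rw [← corner_quad p m] at he
  rcases eq_or_eq_of_side_eq he with h | h
  · left
    rw [lsq_mk, ← h]
    exact inF_of_mem hchar hs
  · right
    rw [rsq_mk, ← quad_add_dir_add_three, ← h]
    exact inF_of_mem hchar hs

/-- The edges of `E` are lattice edges. [folklore] -/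
theorem mem_edgeSet : ∀ e ∈ E, e ∈ (zdGraph 2).edgeSet := by
  intro e he
  obtain ⟨s, -, j, rfl⟩ := (hchar e).1 he
  exact (SimpleGraph.mem_edgeSet _).2 (WindowRect.zdGraph_adj_add_dir _ _)

/-! ### Connectedness of the vertices -/

/-- A vertex of `E` is a corner of a square of `F`. [folklore] -/
theorem exists_eq_corner_of_mem_verts {x : Site 2} (hx : x ∈ verts E) : ∃ s ∈ F, ∃ j : Fin 4, x = corner s j := by
  obtain ⟨e, he, hxe⟩ := Finset.mem_biUnion.1 hx
  obtain ⟨s, hs, j, rfl⟩ := (hchar e).1 he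
  simp only [endpts, Sym2.lift_mk, Finset.mem_insert, Finset.mem_singleton] at hxe
  rcases hxe with rfl | rfl
  · exact ⟨s, hs, j, rfl⟩
  · exact ⟨s, hs, j + 1, (corner_add_one s j).symm⟩

/-- Going round a square of `F` from its base corner. [folklore] -/
theorem reflTransGen_corner_zero_left {s : Site 2} (hs : s ∈ F) (j : Fin 4) :
    Relation.ReflTransGen (fun a b : Site 2 => s(a, b) ∈ E) (corner s 0) (corner s j) := by
  have st : ∀ k : Fin 4, s(corner s k, corner s (k + 1)) ∈ E := side_mem hchar hs
  fin_cases j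
  · exact .refl
  · exact .single (st 0)
  · exact (Relation.ReflTransGen.single (st 0)).tail (st 1)
  · exact ((Relation.ReflTransGen.single (st 0)).tail (st 1)).tail (st 2)

/-- Going round a square of `F` to its base corner. [folklore] -/
theorem reflTransGen_corner_zero_right {s : Site 2} (hs : s ∈ F) (j : Fin 4) :
    Relation.ReflTransGen (fun a b : Site 2 => s(a, b) ∈ E) (corner s j) (corner s 0) := by
  have st : ∀ k : Fin 4, s(corner s k, corner s (k + 1)) ∈ E := side_mem hchar hs
  fin_cases j
  · exact .refl
  · exact ((Relation.ReflTransGen.single (st 1)).tail (st 2)).tail (st 3)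
  · exact (Relation.ReflTransGen.single (st 2)).tail (st 3)
  · exact .single (st 3)

/-- Any two corners of a square of `F` are joined through edges of `E`. [folklore] -/
theorem reflTransGen_corner {s : Site 2} (hs : s ∈ F) (i j : Fin 4) :
    Relation.ReflTransGen (fun a b : Site 2 => s(a, b) ∈ E) (corner s i) (corner s j) :=
  (reflTransGen_corner_zero_right hchar hs i).trans (reflTransGen_corner_zero_left hchar hs j)

/-- Along a chain of side-adjacent squares of `F`, the base corners are joined through edges of `E`.
[folklore] -/
theorem reflTransGen_corner_zero {s t : Site 2}
    (h : Relation.ReflTransGen (fun a b : Site 2 => a ∈ F ∧ b ∈ F ∧ (zdGraph 2).Adj a b) s t) :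
    Relation.ReflTransGen (fun a b : Site 2 => s(a, b) ∈ E) (corner s 0) (corner t 0) := by
  induction h with
  | refl => exact .refl
  | @tail b c _ hbc ih =>
    obtain ⟨hb, hc, hadj⟩ := hbc
    obtain ⟨k, rfl⟩ := WindowRect.exists_eq_add_dir_of_adj hadj
    refine ih.trans ((reflTransGen_corner hchar hb 0 (k + 1)).trans ?_)
    rw [← corner_add_dir]
    exact reflTransGen_corner hchar hc k 0

/-- **`E` is connected**: if `F` is side-connected, any two vertices of `E` are joined through edges of
`E`. [folklore] -/
theorem reflTransGen_of_mem_verts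
    (hconn : ∀ s ∈ F, ∀ t ∈ F,
      Relation.ReflTransGen (fun a b : Site 2 => a ∈ F ∧ b ∈ F ∧ (zdGraph 2).Adj a b) s t) :
    ∀ x ∈ verts E, ∀ y ∈ verts E, Relation.ReflTransGen (fun a b : Site 2 => s(a, b) ∈ E) x y := by
  intro x hx y hy
  obtain ⟨s, hs, j, rfl⟩ := exists_eq_corner_of_mem_verts hchar hx
  obtain ⟨t, ht, j', rfl⟩ := exists_eq_corner_of_mem_verts hchar hy
  exact ((reflTransGen_corner hchar hs j 0).trans (reflTransGen_corner_zero hchar (hconn s hs t ht))).trans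
    (reflTransGen_corner hchar ht 0 j')

/-! ### Escape of exterior squares -/

/-- **A face step crosses a side not in `E`**: if `a` and `b` are side-adjacent squares off `F`, then
`b` is the square across some side `j` of `a`, and that side is not in `E` (the only squares having it
as a side are `a` and `b`). [folklore] -/
theorem faceStep_elim {a b : Site 2} (h : FaceStep (↑F : Set (Site 2)) a b) :
    ∃ j : Fin 4, b = a + dir (j + 3) ∧ s(corner a j, corner a j + dir j) ∉ E := by
  obtain ⟨hadj, ha, hb⟩ := h
  obtain ⟨k, rfl⟩ := WindowRect.exists_eq_add_dir_of_adj hadj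
  have k1 : ∀ k : Fin 4, k + 1 + 3 = k := by decide
  refine ⟨k + 1, by rw [k1], fun hmem => ?_⟩
  obtain ⟨s, hs, j', he⟩ := (hchar _).1 hmem
  rcases eq_or_eq_of_side_eq he with rfl | rfl
  · exact ha (Finset.mem_coe.2 hs)
  · rw [k1] at hs
    exact hb (Finset.mem_coe.2 hs)

/-- **Exterior squares escape**: if `F` is hole-free, from every square with a missing side one can walk
to arbitrarily high squares through side-adjacent squares, each time across a side not in `E`.
[folklore] -/
theorem escape (hHF : HoleFree (↑F : Set (Site 2))) :
    ∀ g : Site 2, (∃ j : Fin 4, s(corner g j, corner g j + dir j) ∉ E) → ∀ M : ℤ, ∃ g' : Site 2,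
      M ≤ g' 1 ∧ Relation.ReflTransGen
        (fun a b : Site 2 => ∃ j : Fin 4, b = a + dir (j + 3) ∧ s(corner a j, corner a j + dir j) ∉ E) g g' := by
  rintro g ⟨j, hj⟩ M
  have hg : g ∉ (↑F : Set (Site 2)) := fun h => not_mem_of_side_not_mem hchar hj (Finset.mem_coe.1 h)
  obtain ⟨g', hM, hchain⟩ := hHF g hg M
  refine ⟨g', hM, ?_⟩
  clear hM
  induction hchain with
  | refl => exact .refl
  | tail _ hbc ih => exact ih.tail (faceStep_elim hchar hbc)

/-! ### The presentation -/

/-- **Cover**: the orbit of any external dart passes through every external dart. [folklore] -/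
theorem cover (hHF : HoleFree (↑F : Set (Site 2)))
    (hconn : ∀ s ∈ F, ∀ t ∈ F,
      Relation.ReflTransGen (fun a b : Site 2 => a ∈ F ∧ b ∈ F ∧ (zdGraph 2).Adj a b) s t)
    {d₀ : Site 2 × Fin 4} (hd₀ : IsExtDart E d₀) {N : ℕ} (hN0 : 0 < N) (hN : (succ E)^[N] d₀ = d₀)
    (hinj : ∀ i j, i < N → j < N → (succ E)^[i] d₀ = (succ E)^[j] d₀ → i = j)
    {d : Site 2 × Fin 4} (hd : IsExtDart E d) : ∃ i < N, (succ E)^[i] d₀ = d :=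
  exists_iterate_succ_eq_of_escape (mem_edgeSet hchar) (reflTransGen_of_mem_verts hchar hconn)
    (escape hchar hHF) hd₀ hN0 hN hinj hd

/-- **The presentation**: period, injectivity, cover and `IsRect` for every cut into four positive arcs.
[folklore] -/
theorem exists_period_cover_isRect (hHF : HoleFree (↑F : Set (Site 2)))
    (hconn : ∀ s ∈ F, ∀ t ∈ F,
      Relation.ReflTransGen (fun a b : Site 2 => a ∈ F ∧ b ∈ F ∧ (zdGraph 2).Adj a b) s t)
    (d₀ : Site 2 × Fin 4) (hd₀ : IsExtDart E d₀) :
    ∃ N : ℕ, 0 < N ∧ (succ E)^[N] d₀ = d₀ ∧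
      (∀ i j : ℕ, i < N → j < N → (succ E)^[i] d₀ = (succ E)^[j] d₀ → i = j) ∧
      (∀ d, IsExtDart E d → ∃ i < N, (succ E)^[i] d₀ = d) ∧
      (∀ n : Fin 4 → ℕ, (∀ j, 0 < n j) → n 0 + n 1 + n 2 + n 3 = N → IsRect E d₀ n) := by
  obtain ⟨N, hN0, hN, hinj⟩ := discreteRect_exists_period hd₀
  have hcov : ∀ d, IsExtDart E d → ∃ i < N, (succ E)^[i] d₀ = d := fun d hd =>
    cover hchar hHF hconn hd₀ hN0 hN hinj hd
  refine ⟨N, hN0, hN, hinj, hcov, fun n hpos hsum => ?_⟩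
  exact
    { subset_edgeSet := mem_edgeSet hchar
      isExtDart := hd₀
      pos := hpos
      periodic := by rw [hsum]; exact hN
      injOn := by rw [hsum]; exact hinj
      cover := by rw [hsum]; exact hcov }

end IsRectOfFaces

open IsRectOfFaces in
/-- **Registered stub `stub_loopSymmetricLimit_isRect_of_faces`** of the n = 0 bridge of the crux
`IsingJetsConformal` (stmt-CriticalPhenomena-5560): for the edge set `E` of all sides of a nonempty,
side-connected, hole-free finite set `F` of unit squares, `E` is a face domain, and the boundary-tracing
orbit of every external dart `d₀` has a period `N > 0`, is injective on `[0, N)`, passes through every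
external dart, and `(E, d₀, n)` is a discrete topological rectangle (`DiscreteRect.IsRect`) for every
`n : Fin 4 → ℕ` with positive entries summing to `N`. [folklore] -/
theorem stub_loopSymmetricLimit_isRect_of_faces : (∀ (F : Finset (Literature.Probability.LatticeModels.Site 2)), F.Nonempty → Literature.Probability.LatticeModels.HoleFree (↑F : Set (Literature.Probability.LatticeModels.Site 2)) → (∀ s ∈ F, ∀ t ∈ F, Relation.ReflTransGen (fun a b : Literature.Probability.LatticeModels.Site 2 ↦ a ∈ F ∧ b ∈ F ∧ (Literature.Probability.LatticeModels.zdGraph 2).Adj a b) s t) → ∀ (E : Finset (Sym2 (Literature.Probability.LatticeModels.Site 2))), (∀ e, e ∈ E ↔ ∃ s ∈ F, ∃ j : Fin 4, e = s(Literature.Probability.LatticeModels.DiscreteRect.corner s j, Literature.Probability.LatticeModels.DiscreteRect.corner s j + Literature.Probability.LatticeModels.DiscreteRect.dir j)) → Literature.Probability.LatticeModels.DiscreteRect.IsFaceDomain E ∧ ∀ (d₀ : Literature.Probability.LatticeModels.Site 2 × Fin 4), Literature.Probability.LatticeModels.DiscreteRect.IsExtDart E d₀ → ∃ N : ℕ,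 0 < N ∧ (Literature.Probability.LatticeModels.DiscreteRect.succ E)^[N] d₀ = d₀ ∧ (∀ i j : ℕ, i < N → j < N → (Literature.Probability.LatticeModels.DiscreteRect.succ E)^[i] d₀ = (Literature.Probability.LatticeModels.DiscreteRect.succ E)^[j] d₀ → i = j) ∧ (∀ d, Literature.Probability.LatticeModels.DiscreteRect.IsExtDart E d → ∃ i < N, (Literature.Probability.LatticeModels.DiscreteRect.succ E)^[i] d₀ = d) ∧ (∀ n : Fin 4 → ℕ, (∀ j, 0 < n j) → n 0 + n 1 + n 2 + n 3 = N → Literature.Probability.LatticeModels.DiscreteRect.IsRect E d₀ n)) := by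
  intro F _ hHF hconn E hchar
  exact ⟨isFaceDomain hchar, fun d₀ hd₀ => exists_period_cover_isRect hchar hHF hconn d₀ hd₀⟩

end Summit.CriticalPhenomena.CardyFormulaZ2.Theorems.CardyQContinuation
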